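import Mathlib
import HarnessLib
import Literature.Geometry.Lorentzian.KerrConvergence

/-!
# The growing certified radius of a hole chart (diagonal lemma)
# (crux `StarvedNecks.NeckGapDecay`, stmt-FinalStateConjecture-16768, line `Sketch`; helper for the physics stub)

A final-state decomposition certifies each hole chart at every FIXED radius: for every `R`,
`truncDeviationCk Bᵢ Ψᵢ k R τ → 0` as `τ → ∞`.  By a diagonal argument there is then ONE non-decreasing
radius function `R_g(τ) → ∞` along which the certificate still tends to `0`:
`truncDeviationCk Bᵢ Ψᵢ k (R_g τ) τ → 0`.  The annulus `{R_g(τ) < rᵢ ≤ ρᵢ + 1}` between this growing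
certified radius and the flat chart's excision is the GAP of the crux `NeckGapDecay` (the region certified
by neither input chart); the lemma is what makes "the gap" a typed object for the physics stub
`stub_gapAnalyticCert` of `Cruxes/NeckGapDecay/Lines/Sketch.lean` and for any re-lining of it.

* `exists_growing_level` — the abstract diagonal lemma: if `f R τ → 0` as `τ → ∞` for every real level
  `R`, there is a non-decreasing `g → ∞` with `f (g τ) τ → 0` (levels `n + 1`, thresholds `max Tₙ n`,
  `g τ = 1 + #{levels passed}` via `sSup` on `ℕ`).
* `exists_growing_certified_radius` — the instance for `Spacetime.truncDeviationCk` of a hole chart of a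
  `FinalStateDecomposition`.

References: DHRT arXiv:2104.08222, §1 (fixed-radius convergence vocabulary). [folklore]
-/

noncomputable section

open scoped Topology ENNReal
open Filter Set Literature.Geometry.Lorentzian

namespace Summit.FinalStateConjecture.FinalStateConjecture.Theorems.NeckGapDecay.ConnectionLevelCones.GrowingRadius
set_option linter.dupNamespace false

/-- **Diagonal lemma for a real parameter.**  If `f R τ → 0` as `τ → ∞` for every level `R : ℝ`
(`f` valued in `ℝ≥0∞`), then there is a non-decreasing `g : ℝ → ℝ` with `g τ → ∞` and
`f (g τ) τ → 0`.  Construction: thresholds `T' n := max (T n) n` where `f (n+1) τ ≤ (n+1)⁻¹` for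
`τ ≥ T n`; `N τ := sSup {n | T' n ≤ τ}` and `g τ := N τ + 1`. [folklore] -/
theorem exists_growing_level {f : ℝ → ℝ → ℝ≥0∞} (hf : ∀ R : ℝ, Tendsto (f R) atTop (𝓝 0)) :
    ∃ g : ℝ → ℝ, Monotone g ∧ Tendsto g atTop atTop ∧ Tendsto (fun τ ↦ f (g τ) τ) atTop (𝓝 0) := by
  -- thresholds
  have hT : ∀ n : ℕ, ∃ T : ℝ, ∀ τ, T ≤ τ → f ((n : ℝ) + 1) τ ≤ ((n : ℝ≥0∞) + 1)⁻¹ := by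
    intro n
    have hpos : (0 : ℝ≥0∞) < ((n : ℝ≥0∞) + 1)⁻¹ := ENNReal.inv_pos.2 (by simp)
    obtain ⟨T, hT⟩ := eventually_atTop.1 ((ENNReal.tendsto_nhds_zero.1 (hf _)) _ hpos)
    exact ⟨T, hT⟩
  choose T hT using hT
  set T' : ℕ → ℝ := fun n ↦ max (T n) n with hT'
  -- the level counter
  set N : ℝ → ℕ := fun τ ↦ sSup {n : ℕ | T' n ≤ τ} with hN
  have hbdd : ∀ τ, BddAbove {n : ℕ | T' n ≤ τ} := by
    intro τ
    refine ⟨Nat.ceil (max τ 0), fun n hn ↦ ?_⟩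
    have h1 : (n : ℝ) ≤ τ := (le_max_right _ _).trans hn
    exact_mod_cast h1.trans ((le_max_left τ 0).trans (Nat.le_ceil _))
  -- monotonicity of the counter
  have hNmono : Monotone N := by
    intro τ τ' h
    by_cases hne : ({n : ℕ | T' n ≤ τ} : Set ℕ).Nonempty
    · exact csSup_le_csSup (hbdd τ') hne fun n hn ↦ le_trans hn h
    · rw [Set.not_nonempty_iff_eq_empty] at hne
      simp only [hN, hne, csSup_empty, bot_eq_zero', zero_le]
  -- once level `m` is passed, the counter is at least `m`, and the counter's own threshold is passed
  have hNge : ∀ (m : ℕ) (τ : ℝ), T' m ≤ τ → m ≤ N τ := fun m τ h ↦ le_csSup (hbdd τ) h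
  have hNmem : ∀ τ : ℝ, T' 0 ≤ τ → T' (N τ) ≤ τ := fun τ h ↦
    Nat.sSup_mem ⟨0, h⟩ (hbdd τ)
  refine ⟨fun τ ↦ (N τ : ℝ) + 1, fun τ τ' h ↦ by simpa using hNmono h, ?_, ?_⟩
  · -- `g → ∞`
    refine tendsto_atTop_add_const_right _ _ ?_
    rw [tendsto_natCast_atTop_iff]
    refine tendsto_atTop_atTop.2 fun m ↦ ⟨T' m, fun τ hτ ↦ hNge m τ hτ⟩
  · -- `f (g τ) τ → 0`: for `τ ≥ T' 0`, `f (N τ + 1) τ ≤ (N τ + 1)⁻¹ → 0`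
    have hbound : ∀ τ, T' 0 ≤ τ → f ((N τ : ℝ) + 1) τ ≤ ((N τ : ℝ≥0∞) + 1)⁻¹ := by
      intro τ hτ
      have h1 : T' (N τ) ≤ τ := hNmem τ hτ
      exact hT (N τ) τ ((le_max_left _ _).trans h1)
    have hlim : Tendsto (fun τ ↦ ((N τ : ℝ≥0∞) + 1)⁻¹) atTop (𝓝 0) := by
      have hN' : Tendsto (fun τ ↦ (N τ : ℝ≥0∞) + 1) atTop (𝓝 ⊤) := by
        refine ENNReal.tendsto_nhds_top_iff_nat.2 fun n ↦ ?_
        filter_upwards [eventually_ge_atTop (T' n)] with τ hτ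
        have h1 : (n : ℝ≥0∞) ≤ N τ := by exact_mod_cast hNge n τ hτ
        exact lt_of_le_of_lt h1 (ENNReal.lt_add_right (by simp) one_ne_zero)
      exact ENNReal.inv_top ▸ tendsto_inv_iff.2 hN'
    refine tendsto_of_tendsto_of_tendsto_of_le_of_le' tendsto_const_nhds hlim
      (Eventually.of_forall fun _ ↦ bot_le) ?_
    filter_upwards [eventually_ge_atTop (T' 0)] with τ hτ using hbound τ hτ

/-- **Growing certified radius of a hole chart.**  For a `Cᵏ` final-state decomposition `d` and a hole
`i` there is a non-decreasing radius function `R_g → ∞` along which the hole chart is still certified: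
the truncated `Cᵏ` deviation of `Ψᵢ` from boosted Kerrᵢ on `{tᵢ = τ, rᵢ ≤ R_g(τ)}` tends to `0`
(diagonal over the fixed-radius certificates `d.tendsto_truncDeviationCk i R`).  DHRT arXiv:2104.08222, §1.
[folklore] -/
theorem exists_growing_certified_radius {𝓢 : Spacetime.{0} 4} {O : Set 𝓢.carrier} {k : ℕ}
    (d : FinalStateDecomposition 𝓢 O k) (i : Fin d.N) :
    ∃ Rg : ℝ → ℝ, Monotone Rg ∧ Tendsto Rg atTop atTop ∧
      Tendsto (fun τ ↦ 𝓢.truncDeviationCk (d.background i) (d.chart i) k (Rg τ) τ) atTop (𝓝 0) :=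
  exists_growing_level fun R ↦ d.tendsto_truncDeviationCk i R

end Summit.FinalStateConjecture.FinalStateConjecture.Theorems.NeckGapDecay.ConnectionLevelCones.GrowingRadius

end
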